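import Summits.Ventures.PercRepro.RankDistLubellUpSet

/-!
# PercRepro — THE LUBELL WEIGHTS OF THE RANK LEVELS, V: the quotient form (Q) and the per-element form (WP1)
of Lubell monotonicity (p9, gen 21)

For a finite matroid `M` on `n` elements, an up-closed family `P` (`UpClosedFin M P`) and an element `y ∈ E`,
write `w(X) = 1 / C(n − 1, |X|)` for `X ⊆ E ∖ y`. Deleting `y` gives the matroid `M ∖ y` on `E ∖ y` with the same
rank function (Mathlib's `M ＼ {y} = M ↾ (E ∖ {y})`); contracting `y` gives the elementary quotient `M / y` with
`ρ_{M/y}(X) = ρ(X ∪ y) − 1`. Both statements below are in `M`'s own vocabulary (no minor is named in them):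
* **(Q) `lubellWP_quot`** — for every `u < ρ(E)`:
  `Σ_{X ⊆ E∖y, P X, ρ(X) = u} w(X) ≤ Σ_{X ⊆ E∖y, P X, ρ(X ∪ y) = u + 1} w(X)`,
  i.e. the Lubell weight of the level `u` of `P` in the deletion `M ∖ y` is at most its Lubell weight in the quotient
  `M / y`. Proof: split the left side by `y ∈ cl(X)`. The sets with `y ∉ cl(X)` have `ρ(X ∪ y) = u + 1`
  (`eRk_insert_eq_add_one`) and already sit on the right. The sets with `y ∈ cl(X)` form the level `u` of the family
  `P ∧ y ∈ cl(·)` — up-closed, closure being monotone — in the matroid `M ∖ y`; its level `u + 1` sits on the right too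
  (`ρ(X ∪ y) = ρ(X)` there, `closure_insert_eq_of_mem_closure`) and is disjoint from the first part (different ranks);
  Lubell monotonicity of `M ∖ y` (`lubellWP_le_succ`) compares the two levels. When `y` is a coloop
  (`y ∉ cl(E ∖ y)`) the second part is empty; otherwise `M ∖ y` has the rank of `M`.
* **(WP1) `lubellWP_perElem`** — for every `u < ρ(E)`:
  `Σ_{P A, ρ(A) = u, y ∉ A} 1/C(n−1, |A|) ≤ Σ_{P A', ρ(A') = u + 1, y ∈ A'} 1/C(n−1, |A'| − 1)`,
  the per-element refinement of (LM): summed over `y ∈ E` (with `(n − |A|)/C(n−1, |A|) = n/C(n, |A|)`) it is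
  `n·W_u(P) ≤ n·W_{u+1}(P)`. From (Q): the right side of (Q) grows when `P X` is relaxed to `P (X ∪ y)` (up-closure),
  and `A' = X ∪ y` re-indexes it.
Nothing here moves any window of the crux.
-/

namespace PercRepro.RankDist

open Set Finset _root_.Matroid PercRepro.ThmH

variable {α : Type} [DecidableEq α] (M : Matroid α) [M.Finite]

/-! ## The deletion `M ∖ y` in the finset vocabulary -/

/-- The ground finset of `M ∖ y` is `E.erase y`. -/
lemma gr_deleteElem (y : α) : gr (M ＼ ({y} : Set α)) = (gr M).erase y := by
  apply Finset.coe_injective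
  rw [coe_gr, Finset.coe_erase, coe_gr, Matroid.delete_ground]

/-- A subset of `E.erase y`, as a set, lies in `E ∖ {y}`. -/
lemma coe_subset_diff_of_subset_erase {y : α} {X : Finset α} (hX : X ⊆ (gr M).erase y) :
    (X : Set α) ⊆ M.E \ {y} := by
  have := Finset.coe_subset.2 hX
  rwa [Finset.coe_erase, coe_gr] at this

/-- On subsets of `E ∖ y` the rank of `M ∖ y` is the rank of `M`. -/
lemma rk_deleteElem {y : α} {X : Finset α} (hX : X ⊆ (gr M).erase y) :
    rk (M ＼ ({y} : Set α)) (X : Set α) = rk M (X : Set α) := by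
  unfold rk
  rw [Matroid.delete_eq_restrict, Matroid.restrict_eRk_eq M (coe_subset_diff_of_subset_erase M hX)]

/-- Membership in a rank level of `M ∖ y`, in `M`'s vocabulary. -/
lemma mem_rankLevelFinP_deleteElem {y : α} {P : Finset α → Prop} {v : ℕ} {X : Finset α} :
    X ∈ rankLevelFinP (M ＼ ({y} : Set α)) P v ↔ X ⊆ (gr M).erase y ∧ rk M (X : Set α) = v ∧ P X := by
  rw [mem_rankLevelFinP, mem_rankLevelFin, gr_deleteElem]
  constructor
  · rintro ⟨⟨h1, h2⟩, h3⟩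
    exact ⟨h1, by rw [← rk_deleteElem M h1]; exact h2, h3⟩
  · rintro ⟨h1, h2, h3⟩
    exact ⟨⟨h1, by rw [rk_deleteElem M h1]; exact h2⟩, h3⟩

omit [DecidableEq α] [M.Finite] in
/-- If `y ∈ cl(E ∖ y)` (`y` is not a coloop), `M ∖ y` has the rank of `M`. -/
lemma eRank_deleteElem_of_mem_closure {y : α} (hy : y ∈ M.closure (M.E \ {y})) :
    (M ＼ ({y} : Set α)).eRank = M.eRank := by
  rw [Matroid.delete_eq_restrict, Matroid.eRank_restrict, Matroid.eRank_def,
    ← Matroid.eRk_closure_eq M (M.E \ {y})]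
  have hcl : M.closure (M.E \ {y}) = M.E := by
    refine subset_antisymm (M.closure_subset_ground _) fun e he => ?_
    by_cases hey : e = y
    · rw [hey]; exact hy
    · exact M.subset_closure (M.E \ {y}) sdiff_subset ⟨he, fun h => hey (Set.mem_singleton_iff.1 h)⟩
  rw [hcl]

/-- `P ∧ y ∈ cl(·)` is up-closed in `M ∖ y` when `P` is up-closed in `M`. -/
lemma upClosedFin_deleteElem_closure {y : α} {P : Finset α → Prop} (hP : UpClosedFin M P) :
    UpClosedFin (M ＼ ({y} : Set α)) (fun X => P X ∧ y ∈ M.closure (X : Set α)) := by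
  intro S T hT hST hS
  rw [gr_deleteElem] at hT
  exact ⟨hP S T (hT.trans (Finset.erase_subset y (gr M))) hST hS.1,
    M.closure_subset_closure (Finset.coe_subset.2 hST) hS.2⟩

/-! ## The rank of `X ∪ y` -/

/-- `y ∉ cl(X)`, `y ∈ E`: `ρ(X ∪ y) = ρ(X) + 1`. -/
lemma rk_insert_of_notMem_closure {y : α} (hy : y ∈ gr M) {X : Finset α} (hX : X ⊆ gr M)
    (hyX : y ∉ M.closure (X : Set α)) : rk M ((insert y X : Finset α) : Set α) = rk M (X : Set α) + 1 := by
  have hXE : (X : Set α) ⊆ M.E := by rw [← coe_gr]; exact Finset.coe_subset.2 hX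
  have hyE : y ∈ M.E := by rw [← coe_gr]; exact_mod_cast hy
  have h := Matroid.eRk_insert_eq_add_one (M := M) (e := y) (X := (X : Set α)) ⟨hyE, hyX⟩
  rw [Finset.coe_insert]
  unfold rk
  rw [h, eRk_eq_coe_rk M hXE, ENat.toNat_coe, ← Nat.cast_one, ← Nat.cast_add, ENat.toNat_coe]

omit [M.Finite] in
/-- `y ∈ cl(X)`: `ρ(X ∪ y) = ρ(X)`. -/
lemma rk_insert_of_mem_closure {y : α} {X : Finset α} (hyX : y ∈ M.closure (X : Set α)) :
    rk M ((insert y X : Finset α) : Set α) = rk M (X : Set α) := by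
  rw [Finset.coe_insert]
  unfold rk
  rw [← Matroid.eRk_closure_eq M (insert y (X : Set α)), Matroid.closure_insert_eq_of_mem_closure hyX,
    Matroid.eRk_closure_eq]

/-! ## (Q): the deletion is dominated by the contraction -/

open scoped Classical in
/-- **(Q) QUOTIENT MONOTONICITY**, in `M`'s vocabulary: for an up-closed `P`, an element `y ∈ E` and `u < ρ(E)`,
`Σ_{X ⊆ E∖y, P X, ρ(X) = u} 1/C(n−1, |X|) ≤ Σ_{X ⊆ E∖y, P X, ρ(X ∪ y) = u+1} 1/C(n−1, |X|)` — the Lubell weight of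
the level `u` of `P` in the deletion `M ∖ y` is at most the one in the contraction `M / y`
(`ρ_{M/y}(X) = ρ(X ∪ y) − 1`). -/
theorem lubellWP_quot {P : Finset α → Prop} (hP : UpClosedFin M P) {p u : ℕ} (hr : M.eRank = (p : ℕ∞))
    (hup : u < p) {y : α} (hy : y ∈ gr M) :
    ∑ X ∈ ((gr M).erase y).powerset.filter (fun X => P X ∧ rk M (X : Set α) = u),
        (1 : ℚ) / (((gr M).card - 1).choose X.card : ℚ)
      ≤ ∑ X ∈ ((gr M).erase y).powerset.filter
            (fun X => P X ∧ rk M ((insert y X : Finset α) : Set α) = u + 1),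
          (1 : ℚ) / (((gr M).card - 1).choose X.card : ℚ) := by
  set E' := (gr M).erase y with hE'
  set w : Finset α → ℚ := fun X => (1 : ℚ) / (((gr M).card - 1).choose X.card : ℚ) with hw
  have hw0 : ∀ X, 0 ≤ w X := fun X => by
    simp only [hw]
    exact div_nonneg zero_le_one (Nat.cast_nonneg _)
  set L := E'.powerset.filter (fun X => P X ∧ rk M (X : Set α) = u) with hL
  set R := E'.powerset.filter (fun X => P X ∧ rk M ((insert y X : Finset α) : Set α) = u + 1) with hR
  set S0 := E'.powerset.filter (fun X => P X ∧ rk M (X : Set α) = u ∧ y ∉ M.closure (X : Set α)) with hS0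
  set S1 := E'.powerset.filter (fun X => P X ∧ rk M (X : Set α) = u ∧ y ∈ M.closure (X : Set α)) with hS1
  set T1 := E'.powerset.filter (fun X => P X ∧ rk M (X : Set α) = u + 1 ∧ y ∈ M.closure (X : Set α)) with hT1
  show ∑ X ∈ L, w X ≤ ∑ X ∈ R, w X
  -- the left side splits by `y ∈ cl(X)`
  have hsplit : ∑ X ∈ L, w X = ∑ X ∈ S0, w X + ∑ X ∈ S1, w X := by
    rw [← Finset.sum_filter_add_sum_filter_not L (fun X => y ∉ M.closure (X : Set α))]
    congr 1
    · apply Finset.sum_congr _ (fun _ _ => rfl)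
      ext X
      simp only [hL, hS0, Finset.mem_filter, Finset.mem_powerset]
      tauto
    · apply Finset.sum_congr _ (fun _ _ => rfl)
      ext X
      simp only [hL, hS1, Finset.mem_filter, Finset.mem_powerset, not_not]
      tauto
  -- `S0 ⊆ R`: `y ∉ cl(X)` raises the rank
  have hS0R : S0 ⊆ R := by
    intro X hX
    simp only [hS0, Finset.mem_filter, Finset.mem_powerset] at hX
    simp only [hR, Finset.mem_filter, Finset.mem_powerset]
    refine ⟨hX.1, hX.2.1, ?_⟩
    rw [rk_insert_of_notMem_closure M hy (hX.1.trans (Finset.erase_subset y (gr M))) hX.2.2.2, hX.2.2.1]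
  -- `T1 ⊆ R`: `y ∈ cl(X)` keeps the rank
  have hT1R : T1 ⊆ R := by
    intro X hX
    simp only [hT1, Finset.mem_filter, Finset.mem_powerset] at hX
    simp only [hR, Finset.mem_filter, Finset.mem_powerset]
    refine ⟨hX.1, hX.2.1, ?_⟩
    rw [rk_insert_of_mem_closure M hX.2.2.2, hX.2.2.1]
  -- `S0` and `T1` are disjoint (ranks `u` and `u + 1`)
  have hdisj : Disjoint S0 T1 := by
    rw [Finset.disjoint_left]
    intro X h0 h1
    simp only [hS0, Finset.mem_filter, Finset.mem_powerset] at h0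
    simp only [hT1, Finset.mem_filter, Finset.mem_powerset] at h1
    omega
  -- `S1` and `T1` are the levels `u` and `u + 1` of `P ∧ y ∈ cl(·)` in `M ∖ y`
  set P' : Finset α → Prop := fun X => P X ∧ y ∈ M.closure (X : Set α) with hP'
  have hS1eq : S1 = rankLevelFinP (M ＼ ({y} : Set α)) P' u := by
    ext X
    rw [mem_rankLevelFinP_deleteElem]
    simp only [hS1, hP', Finset.mem_filter, Finset.mem_powerset, hE']
    tauto
  have hT1eq : T1 = rankLevelFinP (M ＼ ({y} : Set α)) P' (u + 1) := by
    ext X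
    rw [mem_rankLevelFinP_deleteElem]
    simp only [hT1, hP', Finset.mem_filter, Finset.mem_powerset, hE']
    tauto
  have hcard : (gr (M ＼ ({y} : Set α))).card = (gr M).card - 1 := by
    rw [gr_deleteElem, Finset.card_erase_of_mem hy]
  have hS1W : ∑ X ∈ S1, w X = lubellWP (M ＼ ({y} : Set α)) P' u := by
    unfold lubellWP
    rw [hcard, hS1eq]
  have hT1W : ∑ X ∈ T1, w X = lubellWP (M ＼ ({y} : Set α)) P' (u + 1) := by
    unfold lubellWP
    rw [hcard, hT1eq]
  -- Lubell monotonicity of `M ∖ y` (or `S1 = ∅` when `y` is a coloop)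
  have hS1T1 : ∑ X ∈ S1, w X ≤ ∑ X ∈ T1, w X := by
    by_cases hcol : y ∈ M.closure (M.E \ {y})
    · rw [hS1W, hT1W]
      exact lubellWP_le_succ (M ＼ ({y} : Set α)) (upClosedFin_deleteElem_closure M hP)
        (by rw [eRank_deleteElem_of_mem_closure M hcol, hr]) hup
    · have hS1empty : S1 = ∅ := by
        rw [Finset.eq_empty_iff_forall_notMem]
        intro X hX
        simp only [hS1, Finset.mem_filter, Finset.mem_powerset] at hX
        exact hcol (M.closure_subset_closure (coe_subset_diff_of_subset_erase M hX.1) hX.2.2.2)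
      rw [hS1empty, Finset.sum_empty]
      exact Finset.sum_nonneg fun X _ => hw0 X
  -- assemble
  calc ∑ X ∈ L, w X = ∑ X ∈ S0, w X + ∑ X ∈ S1, w X := hsplit
    _ ≤ ∑ X ∈ S0, w X + ∑ X ∈ T1, w X := by gcongr
    _ = ∑ X ∈ S0 ∪ T1, w X := (Finset.sum_union hdisj).symm
    _ ≤ ∑ X ∈ R, w X :=
        Finset.sum_le_sum_of_subset_of_nonneg (Finset.union_subset hS0R hT1R) fun X _ _ => hw0 X

/-! ## (WP1): the per-element Lubell inequality -/

open scoped Classical in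
/-- **(WP1) THE PER-ELEMENT LUBELL INEQUALITY**: for an up-closed `P`, an element `y ∈ E` and `u < ρ(E)`,
`Σ_{P A, ρ(A) = u, y ∉ A} 1/C(n−1, |A|) ≤ Σ_{P A', ρ(A') = u + 1, y ∈ A'} 1/C(n−1, |A'| − 1)`.
Summed over `y ∈ E` it is `n·W_u(P) ≤ n·W_{u+1}(P)`: the per-element refinement of Lubell monotonicity. -/
theorem lubellWP_perElem {P : Finset α → Prop} (hP : UpClosedFin M P) {p u : ℕ} (hr : M.eRank = (p : ℕ∞))
    (hup : u < p) {y : α} (hy : y ∈ gr M) :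
    ∑ A ∈ (rankLevelFinP M P u).filter (fun A => y ∉ A),
        (1 : ℚ) / (((gr M).card - 1).choose A.card : ℚ)
      ≤ ∑ A ∈ (rankLevelFinP M P (u + 1)).filter (fun A => y ∈ A),
          (1 : ℚ) / (((gr M).card - 1).choose (A.card - 1) : ℚ) := by
  set E' := (gr M).erase y with hE'
  set w : Finset α → ℚ := fun X => (1 : ℚ) / (((gr M).card - 1).choose X.card : ℚ) with hw
  have hw0 : ∀ X, 0 ≤ w X := fun X => by
    simp only [hw]
    exact div_nonneg zero_le_one (Nat.cast_nonneg _)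
  -- the left side is the left side of (Q)
  have hL : (rankLevelFinP M P u).filter (fun A => y ∉ A)
      = E'.powerset.filter (fun X => P X ∧ rk M (X : Set α) = u) := by
    ext X
    simp only [Finset.mem_filter, mem_rankLevelFinP, mem_rankLevelFin, Finset.mem_powerset, hE',
      Finset.subset_erase]
    tauto
  -- the right side of (Q) grows when `P X` is relaxed to `P (X ∪ y)`
  set R' := E'.powerset.filter (fun X => P (insert y X) ∧ rk M ((insert y X : Finset α) : Set α) = u + 1)
    with hR'
  have hRR' : E'.powerset.filter (fun X => P X ∧ rk M ((insert y X : Finset α) : Set α) = u + 1) ⊆ R' := by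
    intro X hX
    simp only [Finset.mem_filter, Finset.mem_powerset] at hX
    simp only [hR', Finset.mem_filter, Finset.mem_powerset]
    refine ⟨hX.1, hP X (insert y X) ?_ (Finset.subset_insert y X) hX.2.1, hX.2.2⟩
    exact Finset.insert_subset hy (hX.1.trans (Finset.erase_subset y (gr M)))
  -- re-index `R'` by `A' = X ∪ y`
  have hreindex : ∑ X ∈ R', w X
      = ∑ A ∈ (rankLevelFinP M P (u + 1)).filter (fun A => y ∈ A),
          (1 : ℚ) / (((gr M).card - 1).choose (A.card - 1) : ℚ) := by
    refine Finset.sum_nbij' (fun X => insert y X) (fun A => A.erase y) ?_ ?_ ?_ ?_ ?_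
    · intro X hX
      simp only [hR', Finset.mem_filter, Finset.mem_powerset] at hX
      simp only [Finset.mem_filter, mem_rankLevelFinP, mem_rankLevelFin, Finset.mem_insert_self, and_true]
      exact ⟨⟨Finset.insert_subset hy (hX.1.trans (Finset.erase_subset y (gr M))), hX.2.2⟩, hX.2.1⟩
    · intro A hA
      simp only [Finset.mem_filter, mem_rankLevelFinP, mem_rankLevelFin] at hA
      simp only [hR', Finset.mem_filter, Finset.mem_powerset, hE', Finset.insert_erase hA.2]
      exact ⟨Finset.erase_subset_erase y hA.1.1.1, hA.1.2, hA.1.1.2⟩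
    · intro X hX
      simp only [hR', Finset.mem_filter, Finset.mem_powerset] at hX
      have hyX : y ∉ X := fun h => Finset.notMem_erase y (gr M) (hX.1 h)
      exact Finset.erase_insert hyX
    · intro A hA
      simp only [Finset.mem_filter] at hA
      exact Finset.insert_erase hA.2
    · intro X hX
      simp only [hR', Finset.mem_filter, Finset.mem_powerset] at hX
      have hyX : y ∉ X := fun h => Finset.notMem_erase y (gr M) (hX.1 h)
      simp only [hw, Finset.card_insert_of_notMem hyX, Nat.add_sub_cancel]
  calc ∑ A ∈ (rankLevelFinP M P u).filter (fun A => y ∉ A), w A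
      = ∑ X ∈ E'.powerset.filter (fun X => P X ∧ rk M (X : Set α) = u), w X := by rw [hL]
    _ ≤ ∑ X ∈ E'.powerset.filter (fun X => P X ∧ rk M ((insert y X : Finset α) : Set α) = u + 1), w X :=
        lubellWP_quot M hP hr hup hy
    _ ≤ ∑ X ∈ R', w X := Finset.sum_le_sum_of_subset_of_nonneg hRR' fun X _ _ => hw0 X
    _ = _ := hreindex

end PercRepro.RankDist
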